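/-
Copyright (c) 2026. All rights reserved.
Released under Apache 2.0 license as described in the file LICENSE.
Authors: abc-iut cell, wave-4 seat abc-iut-w4-d059 (proof-only; sub-DAG [SemiAnbd] Thm 5.4 row T54-0b core:
«commensurator of the geometric vertex group = arithmetic stabiliser of its tree vertex»).
-/
import Mathlib.GroupTheory.Commensurable
import Mathlib.Tactic.Group
import Literature.AnabelianGeometry.SemiGraphs.TreeSystemFixedPoint
import HarnessLib

/-!
# [SemiAnbd] §5 p. 65: the commensurator description of the arithmetic decomposition groups —
# generic core («`C_{Π^temp_𝔊}(Π^temp_{𝔾,v}) = Stab_{Π^temp_𝔊}(ṽ)`»)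

Mochizuki, *Semi-graphs of anabelioids*, Publ. RIMS **42** (2006), §5, manuscript p. 65
[cite: MochizukiSemiAnbd2006, §5, p. 65]: "for every vertex `v` of `𝔾`, we obtain an associated
decomposition group `Π^temp_{𝔊,v} ⊆ Π^temp_𝔊` [well-defined up to conjugation in `Π^temp_𝔊`], which [by
Corollary 2.7, (i), (iii); the injection of Proposition 3.6, (iii)] may be thought of as the commensurator in
`Π^temp_𝔊` of `Π^temp_{𝔾,v} := Π^temp_{𝔊,v} ∩ Π^temp_𝔾`."

PROOF-ONLY (no definition; sub-DAG `plan/L3/SUBDAG-SemiAnbd-Thm54.md`, row T54-0b, L3-lead gen 3 γ3-6 (a)):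
the GENERIC group-theoretic core of the bracket "[Cor 2.7 (i), (iii); Prop 3.6 (iii)]", over loose
binders.  Setting: a group `Gtp` ("`Π^temp_𝔊`") acting on a system of semi-graphs `T j` through
`ρ j : Gtp →* Aut (T j)` with `Gtp`-equivariant transition maps, a subgroup embedded by an injective
`ι : N → Gtp` with NORMAL image ("`Π^temp_𝔾 ⊆ Π^temp_𝔊`", Prop 5.2 (iv)), and a family `VN` of subgroups of `N`
("the geometric verticial subgroups") that is a TWO-SIDED DICTIONARY with the compatible systems of tree
vertices: every compatible system has a full stabiliser in `N` lying in `VN` (`hstabN`), two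
commensurable members of `VN` are EQUAL (`hrigid` — Thm 3.7 (ii) `VerticialDistinct`), and a member of
`VN` fixes at most one compatible system (`huniq` — a verticial subgroup lies in no edge-like one).  Then
(`mem_commensurator_map_iff_fixes`): for `H ∈ VN` the full stabiliser of the compatible system `x`,
an element `g ∈ Gtp` commensurates `ι(H)` IF AND ONLY IF `g` fixes `x` — i.e. the arithmetic decomposition
group DEFINED as a commensurator (abc-iut-w4-d053's `arithVertGp`, `ArithDecompositionData.lean`) is the
pointwise stabiliser of the tree vertex (the field `fix` of `ArithLevelData`).  Proof: `g·ι(H)·g⁻¹` is the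
image of the `N`-stabiliser of `g·x`, a member of `VN` (normality + the dictionary); commensurability pulls
back along the injective `ι` (`Subgroup.relIndex_map_map_of_injective`), rigidity identifies the two
members, and uniqueness of the fixed system gives `g·x = x`.  Nothing here asserts a statement of the
paper; nothing bears on [IUTchIII] Cor. 3.12.
-/

namespace Literature.AnabelianGeometry.SemiGraphs

open CategoryTheory
open scoped Pointwise

universe v u u' w

variable {N : Type u} [Group N] {Gtp : Type u'} [Group Gtp] (ι : N →* Gtp)
variable {J : Type v} [Preorder J] (T : J → SemiGraph.{w}) (ρ : ∀ j, Gtp →* Aut (T j))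
  (f : ∀ ⦃i j : J⦄, i ≤ j → (T j ⟶ T i))

/-! ### Bookkeeping for actions through `Aut` -/

omit [Preorder J] in
/-- The action of a product on a vertex. [cite: MochizukiSemiAnbd2006, Thm 3.7(iii) p.41] -/
theorem act_mul_vertexMap (j : J) (a b : Gtp) (y : (T j).Vertex) :
    (ρ j (a * b)).hom.vertexMap y = (ρ j a).hom.vertexMap ((ρ j b).hom.vertexMap y) := by
  rw [map_mul]; rfl

omit [Preorder J] in
/-- The action of the identity on a vertex. [cite: MochizukiSemiAnbd2006, Thm 3.7(iii) p.41] -/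
theorem act_one_vertexMap (j : J) (y : (T j).Vertex) : (ρ j 1).hom.vertexMap y = y := by
  rw [map_one]; rfl

omit [Preorder J] in
/-- `g⁻¹` undoes `g` on vertices. [cite: MochizukiSemiAnbd2006, Thm 3.7(iii) p.41] -/
theorem act_inv_act_vertexMap (j : J) (g : Gtp) (y : (T j).Vertex) :
    (ρ j g⁻¹).hom.vertexMap ((ρ j g).hom.vertexMap y) = y := by
  rw [← act_mul_vertexMap, inv_mul_cancel, act_one_vertexMap]

omit [Preorder J] in
/-- `g` undoes `g⁻¹` on vertices. [cite: MochizukiSemiAnbd2006, Thm 3.7(iii) p.41] -/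
theorem act_act_inv_vertexMap (j : J) (g : Gtp) (y : (T j).Vertex) :
    (ρ j g).hom.vertexMap ((ρ j g⁻¹).hom.vertexMap y) = y := by
  rw [← act_mul_vertexMap, mul_inv_cancel, act_one_vertexMap]

/-! ### Translating a compatible system -/

/-- The translate `g·x` of a compatible system of vertices by `g ∈ Gtp` is compatible, the transition maps
being equivariant. [cite: MochizukiSemiAnbd2006, Thm 3.7(iii) p.41] -/
theorem compatible_translate
    (hequiv : ∀ ⦃i j : J⦄ (h : i ≤ j) (g : Gtp) (y : (T j).Vertex),
      (f h).vertexMap ((ρ j g).hom.vertexMap y) = (ρ i g).hom.vertexMap ((f h).vertexMap y))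
    {x : ∀ j, (T j).Vertex} (hx : ∀ ⦃i j : J⦄ (h : i ≤ j), (f h).vertexMap (x j) = x i) (g : Gtp) :
    ∀ ⦃i j : J⦄ (h : i ≤ j), (f h).vertexMap ((ρ j g).hom.vertexMap (x j)) = (ρ i g).hom.vertexMap (x i) :=
  fun i j h => by rw [hequiv h g (x j), hx h]

/-! ### The conjugate of the image of a stabiliser -/

omit [Preorder J] in
/-- **The conjugate of the image of the `N`-stabiliser of `x` is the image of the `N`-stabiliser of `g·x`**
(for `ι(N)` normal in `Gtp`): if `H = {n | ι n fixes x}` and `H' = {n | ι n fixes g·x}` then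
`g·ι(H)·g⁻¹ = ι(H')`. [cite: MochizukiSemiAnbd2006, §5, p. 65] -/
theorem conj_map_stabilizer_eq (hnorm : (ι.range).Normal) {x : ∀ j, (T j).Vertex} (g : Gtp)
    {H H' : Subgroup N} (hH : ∀ n : N, n ∈ H ↔ ∀ j, (ρ j (ι n)).hom.vertexMap (x j) = x j)
    (hH' : ∀ n : N, n ∈ H' ↔
      ∀ j, (ρ j (ι n)).hom.vertexMap ((ρ j g).hom.vertexMap (x j)) = (ρ j g).hom.vertexMap (x j)) :
    ConjAct.toConjAct g • H.map ι = H'.map ι := by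
  ext y
  rw [Subgroup.mem_pointwise_smul_iff_inv_smul_mem, ← map_inv, ConjAct.smul_def,
    ConjAct.ofConjAct_toConjAct, inv_inv]
  constructor
  · rintro ⟨n, hn, hny⟩
    -- `g⁻¹ y g = ι n` with `n ∈ H`; so `y = g ι(n) g⁻¹ ∈ ι(N)`, say `y = ι m`
    have hy : y = g * ι n * g⁻¹ := by
      rw [hny]; group
    obtain ⟨m, hm⟩ : y ∈ ι.range := by
      rw [hy]; exact hnorm.conj_mem _ ⟨n, rfl⟩ g
    refine ⟨m, (hH' m).mpr fun j => ?_, hm⟩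
    rw [hm, hy, act_mul_vertexMap, act_mul_vertexMap, act_inv_act_vertexMap, ((hH n).mp hn) j]
  · rintro ⟨m, hm, rfl⟩
    -- `g⁻¹ ι(m) g ∈ ι(N)`, say `= ι n`, and `n` fixes `x`
    obtain ⟨n, hn⟩ : g⁻¹ * ι m * g ∈ ι.range := by
      have := hnorm.conj_mem _ ⟨m, rfl⟩ g⁻¹
      rwa [inv_inv] at this
    refine ⟨n, (hH n).mpr fun j => ?_, hn.symm ▸ by group⟩
    have key := ((hH' m).mp hm) j
    -- apply `g⁻¹` to both sides of `key`
    have key' := congrArg ((ρ j g⁻¹).hom.vertexMap) key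
    rw [act_inv_act_vertexMap, ← act_mul_vertexMap, ← act_mul_vertexMap] at key'
    rw [hn]
    exact key'

/-! ### The commensurator of the image of a geometric vertex group is the arithmetic stabiliser -/

/-- **[SemiAnbd] §5 p. 65, «`Π^temp_{𝔊,v}` = the commensurator in `Π^temp_𝔊` of `Π^temp_{𝔾,v}`» — generic
core (row T54-0b).**  Let `ι : N → Gtp` be injective with normal image, `Gtp` act on the trees `T j`
with equivariant transition maps, and let `VN` be a family of subgroups of `N` such that: (`hstabN`) the
full `N`-stabiliser of every compatible system of tree vertices lies in `VN`; (`hrigid`) commensurable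
members of `VN` are equal (Thm 3.7 (ii)); (`huniq`) a member of `VN` fixes at most one compatible system
(a verticial subgroup lies in no edge-like one).  Then for `H ∈ VN` the full `N`-stabiliser of a compatible
system `x`: `g ∈ C_{Gtp}(ι(H)) ↔ g` fixes `x` pointwise.  In particular the arithmetic decomposition
group of p. 65 (the commensurator `arithVertGp`) is the arithmetic stabiliser of the tree vertex (the
two-sided field `fix` of the arithmetic level data). [cite: MochizukiSemiAnbd2006, §5, p. 65] -/
theorem mem_commensurator_map_iff_fixes (hι : Function.Injective ι) (hnorm : (ι.range).Normal)
    (hequiv : ∀ ⦃i j : J⦄ (h : i ≤ j) (g : Gtp) (y : (T j).Vertex),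
      (f h).vertexMap ((ρ j g).hom.vertexMap y) = (ρ i g).hom.vertexMap ((f h).vertexMap y))
    (VN : Set (Subgroup N))
    (hstabN : ∀ x : ∀ j, (T j).Vertex, (∀ ⦃i j : J⦄ (h : i ≤ j), (f h).vertexMap (x j) = x i) →
      ∃ H ∈ VN, ∀ n : N, n ∈ H ↔ ∀ j, (ρ j (ι n)).hom.vertexMap (x j) = x j)
    (hrigid : ∀ H ∈ VN, ∀ H' ∈ VN, Subgroup.Commensurable H H' → H = H')
    (huniq : ∀ H ∈ VN, ∀ x x' : ∀ j, (T j).Vertex,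
      (∀ ⦃i j : J⦄ (h : i ≤ j), (f h).vertexMap (x j) = x i) →
      (∀ ⦃i j : J⦄ (h : i ≤ j), (f h).vertexMap (x' j) = x' i) →
      (∀ n ∈ H, ∀ j, (ρ j (ι n)).hom.vertexMap (x j) = x j) →
      (∀ n ∈ H, ∀ j, (ρ j (ι n)).hom.vertexMap (x' j) = x' j) → x = x')
    {H : Subgroup N} (hHV : H ∈ VN) {x : ∀ j, (T j).Vertex}
    (hx : ∀ ⦃i j : J⦄ (h : i ≤ j), (f h).vertexMap (x j) = x i)
    (hH : ∀ n : N, n ∈ H ↔ ∀ j, (ρ j (ι n)).hom.vertexMap (x j) = x j) (g : Gtp) :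
    g ∈ Subgroup.Commensurable.commensurator (H.map ι) ↔ ∀ j, (ρ j g).hom.vertexMap (x j) = x j := by
  -- the translated system `g·x` and its `N`-stabiliser `H' ∈ VN`
  set x' : ∀ j, (T j).Vertex := fun j => (ρ j g).hom.vertexMap (x j) with hx'def
  have hx' : ∀ ⦃i j : J⦄ (h : i ≤ j), (f h).vertexMap (x' j) = x' i := compatible_translate T ρ f hequiv hx g
  obtain ⟨H', hH'V, hH'⟩ := hstabN x' hx'
  have hconj : ConjAct.toConjAct g • H.map ι = H'.map ι := conj_map_stabilizer_eq ι T ρ hnorm g hH hH'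
  rw [Subgroup.Commensurable.commensurator_mem_iff, hconj]
  constructor
  · intro hcomm
    -- commensurability pulls back along the injective `ι`, so `H' = H` by rigidity
    have hcomm' : Subgroup.Commensurable H' H := by
      obtain ⟨h1, h2⟩ := hcomm
      rw [Subgroup.relIndex_map_map_of_injective _ _ hι] at h1 h2
      exact ⟨h1, h2⟩
    have hHH' : H' = H := hrigid H' hH'V H hHV hcomm'
    -- `H` fixes both `x` and `g·x`, hence `g·x = x`
    have hfix' : ∀ n ∈ H, ∀ j, (ρ j (ι n)).hom.vertexMap (x' j) = x' j :=
      fun n hn => (hH' n).mp (hHH' ▸ hn)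
    have hxx : x = x' := huniq H hHV x x' hx hx' (fun n hn => (hH n).mp hn) hfix'
    intro j
    exact (congrFun hxx j).symm
  · intro hg
    -- `g·x = x`, so `H' = H` and the conjugate IS `ι(H)`
    have hxx : x' = x := funext hg
    have hHH' : H' = H := by
      ext n; rw [hH' n, hH n, hxx]
    rw [hHH']

end Literature.AnabelianGeometry.SemiGraphs
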